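import Literature.NumberTheory.EllipticCurves.CPMuDescentQBoxNodeKill
import HarnessLib

/-!
# Booking `t_3 = 0` with the ℚ-side local condition: the `α`-box over `ℚ` cut at a split node prime, composed with the `K3`-boxes
# (Cohen–Pazuki 2009, Prop. 2.2 with the local images of Thm. 2.1 (2)–(3))

Topic `NumberTheory/EllipticCurves`. Sequel of `CPMuDescentQBoxNodeKill` (`cubeClass_mem_closure_of_torsorClass_mem_sha_QKill`): the composition
theorems in the shape of `CPMuDescentBoxes.forall_mem_sha_three_nsmul_eq_zero_of_gens_of_box`, with the crude ℚ-side hypothesis `hgen`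
(every `[q]`, `q ∈ S`, a descent class) REPLACED by the ℚ-side local condition at a node prime `p₀ ≡ 1 (mod 3)` — residue certificates
`q ≡ g^{c_q} y_q³`, a pivot `q₀`, and the `|S| − 1` twisted classes `[q · q₀^{f_q}]`:
* `eq_zero_of_mem_sha_of_galH1Map_eq_zero_of_QKill` — `Ш(V/ℚ) ∩ ker f_* = 0`;
* **`forall_mem_sha_three_nsmul_eq_zero_of_QKill_of_box`** — `Ш(E/ℚ)[3] = 0` from the cut ℚ-box and ANY sharp `K3`-box statement `hbox`;
* **`shaCorank_three_eq_zero_of_QKill_splitNodeKill`** — `t_3(E_{m,s}) = 0` BOOKED from the cut ℚ-box and the `K3`-box with one split prime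
  cut at a killing place (`CPMuDescentK3BoxSplitNodeKill`): the shape of the rank-2 census curves with `|S| = 3`, one split prime in `b̂`,
  one ℚ-kill and one `K3`-kill.
Theorems only; no definitions, no named facts.

## References
* [CohenPazuki2009] H. Cohen, F. Pazuki, *Elementary 3-descent with a 3-isogeny*, Acta Arith. 140 (2009), Thm. 2.1, Prop. 2.2.
* [SilvermanAEC2009] J. H. Silverman, *The Arithmetic of Elliptic Curves*, 2nd ed. (2009), Thm. X.4.2 (a), Prop. X.4.9.
-/

noncomputable section

open scoped Classical
open WeierstrassCurve IsDedekindDomain IsDedekindDomain.HeightOneSpectrum NumberField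

namespace Literature.NumberTheory.EllipticCurves

namespace CPMuDescent

open MordellDescent ThreeTorsionDescent MuThreeKernel WithZero
open Literature.NumberTheory.NumberFields Literature.NumberTheory.NumberFields.K3

/-! ## `Ш(V/ℚ) ∩ ker f_* = 0` from the cut ℚ-box -/

/-- **`Ш(V/ℚ)[ψ] = 0` from the `α`-box cut at a split node prime.** As `eq_zero_of_mem_sha_of_galH1Map_eq_zero_of_gens`, with the ℚ-side
local condition at `p₀` in place of the crude generators. [cite: CohenPazuki2009, Theorem 2.1 and Proposition 2.2] [cite: SilvermanAEC2009, Thm. X.4.2 (a)] -/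
theorem eq_zero_of_mem_sha_of_galH1Map_eq_zero_of_QKill {a₂ b₂ t m s : ℚ} (hb : b₂ ≠ 0) (hd : 4 * a₂ ^ 3 + 9 * b₂ ≠ 0) (ht : t ≠ 0)
    (hm₂ : t * m = 3 * a₂) (hs₂ : t ^ 3 * s = 4 * a₂ ^ 3 + 9 * b₂) (S : Finset ℕ) (hS : ∀ p ∈ S, p.Prime)
    (hout : ∀ p : ℕ, p.Prime → p ∉ S → padicValRat p (2 * s) = 0 ∧ 0 ≤ padicValRat p (2 * m))
    {p₀ : ℕ} (hp₀ : p₀.Prime) (hp₀1 : p₀ % 3 = 1)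
    (hsp : padicValRat p₀ s = 0) (hDp : 0 < padicValRat p₀ (27 * s - 4 * m ^ 3))
    {g : ℕ} (hg : (g : ZMod p₀) ^ ((p₀ - 1) / 3) ≠ 1) (hg0 : (g : ZMod p₀) ≠ 0)
    (c y : ℕ → ℕ) (hcert : ∀ q ∈ S, ((q : ℕ) : ZMod p₀) = (g : ZMod p₀) ^ c q * ((y q : ℕ) : ZMod p₀) ^ 3)
    (hy0 : ∀ q ∈ S, ((y q : ℕ) : ZMod p₀) ≠ 0)
    {q₀ : ℕ} (hq₀ : q₀ ∈ S) (hc₀ : ¬ 3 ∣ c q₀) (f : ℕ → ℕ) (hf : ∀ q ∈ S, q ≠ q₀ → 3 ∣ c q + c q₀ * f q)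
    (hgenQ : ∀ q ∈ S, q ≠ q₀ → cubeClass ((q : ℚ) * (q₀ : ℚ) ^ f q) ∈ Subgroup.closure (Set.range
      fun P : (threeTorsionModel m s).toAffine.Point => descentClass (threeTorsionModel m s) m s P))
    {W' : WeierstrassCurve ℚ} (φ : geomPoints (cpCurve a₂ b₂) →+ geomPoints W')
    (hφ : ∀ (σ : Field.absoluteGaloisGroup ℚ) (P : geomPoints (cpCurve a₂ b₂)), φ (σ • P) = σ • φ P)
    (hsurj : Function.Surjective φ)
    (hker : ∀ P, φ P = 0 → P = 0 ∨ P = (kernelDatum hb hd).T ∨ P = -(kernelDatum hb hd).T)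
    {c' : (cpCurve a₂ b₂).galH1} (hc : c' ∈ (cpCurve a₂ b₂).sha) (h0 : galH1Map φ hφ c' = 0) : c' = 0 :=
  (kernelDatum hb hd).eq_zero_of_mem_sha_of_galH1Map_eq_zero_of_closure φ hφ hsurj hker
    (Set.range fun P : (threeTorsionModel m s).toAffine.Point => descentClass (threeTorsionModel m s) m s P)
    (by
      rintro _ ⟨P, rfl⟩
      exact torsorClassQuotHom_descentClass hb hd ht hm₂ hs₂ P)
    (fun _ hu hsha => cubeClass_mem_closure_of_torsorClass_mem_sha_QKill hb hd ht hm₂ hs₂ S hS hout hp₀ hp₀1 hsp hDp hg hg0 c y hcert hy0 hq₀ hc₀ f hf hgenQ hu hsha)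
    hc h0

/-! ## `Ш(E/ℚ)[3] = 0` from the cut ℚ-box and a sharp `K3`-box -/

/-- **`Ш(E/ℚ)[3] = 0` for `E = threeTorsionModel m s` from the `α`-box over `ℚ` CUT at a split node prime `p₀` and the sharp `α̂`-box over
`ℚ(√−3)` (`hbox`).** Canonical Cohen–Pazuki pair `(a, b̂, t) = (m, 3s − 4m³/9, 3)`. [cite: CohenPazuki2009, Proposition 2.2]
[cite: SilvermanAEC2009, Thm. X.4.2 (a)] -/
theorem forall_mem_sha_three_nsmul_eq_zero_of_QKill_of_box {m s : ℚ} [(threeTorsionModel m s).IsElliptic]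
    (S : Finset ℕ) (hS : ∀ p ∈ S, p.Prime)
    (hout : ∀ p : ℕ, p.Prime → p ∉ S → padicValRat p (2 * s) = 0 ∧ 0 ≤ padicValRat p (2 * m))
    {p₀ : ℕ} (hp₀ : p₀.Prime) (hp₀1 : p₀ % 3 = 1)
    (hsp : padicValRat p₀ s = 0) (hDp : 0 < padicValRat p₀ (27 * s - 4 * m ^ 3))
    {g : ℕ} (hg : (g : ZMod p₀) ^ ((p₀ - 1) / 3) ≠ 1) (hg0 : (g : ZMod p₀) ≠ 0)
    (c y : ℕ → ℕ) (hcert : ∀ q ∈ S, ((q : ℕ) : ZMod p₀) = (g : ZMod p₀) ^ c q * ((y q : ℕ) : ZMod p₀) ^ 3)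
    (hy0 : ∀ q ∈ S, ((y q : ℕ) : ZMod p₀) ≠ 0)
    {q₀ : ℕ} (hq₀ : q₀ ∈ S) (hc₀ : ¬ 3 ∣ c q₀) (f : ℕ → ℕ) (hf : ∀ q ∈ S, q ≠ q₀ → 3 ∣ c q + c q₀ * f q)
    (hgenQ : ∀ q ∈ S, q ≠ q₀ → cubeClass ((q : ℚ) * (q₀ : ℚ) ^ f q) ∈ Subgroup.closure (Set.range
      fun P : (threeTorsionModel m s).toAffine.Point => descentClass (threeTorsionModel m s) m s P))
    (a₃ b₃ : K3 → K3) (hb₃ : ∀ θ₀ : K3, θ₀ ^ 2 = -3 → b₃ θ₀ ≠ 0)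
    (hd₃ : ∀ θ₀ : K3, θ₀ ^ 2 = -3 → 4 * a₃ θ₀ ^ 3 + 9 * b₃ θ₀ ≠ 0)
    (hX₃ : ∀ θ₀ : K3, θ₀ ^ 2 = -3 → (threeTorsionModel m s).baseChange K3 = cpCurve (a₃ θ₀) (b₃ θ₀))
    (hy : ∀ θ₀ : K3, θ₀ ^ 2 = -3 → b₃ θ₀ * θ₀ = algebraMap ℚ K3 s)
    (hbox : ∀ (θ₀ : K3) (hθ : θ₀ ^ 2 = -3) {u : K3} (hu : u ≠ 0),
      (kernelDatum (hb₃ θ₀ hθ) (hd₃ θ₀ hθ)).torsorClass hu ∈ (cpCurve (a₃ θ₀) (b₃ θ₀)).sha →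
        (∃ r : ℚ, QuadraticAlgebra.norm u = r ^ 3) → (kernelDatum (hb₃ θ₀ hθ) (hd₃ θ₀ hθ)).torsorClass hu = 0) :
    ∀ c' ∈ (threeTorsionModel m s).sha, 3 • c' = 0 → c' = 0 :=
  forall_mem_sha_three_nsmul_eq_zero_of_boxes canonical_b_ne_zero canonical_d_ne_zero _
    (cpCurve_eq_variableChange_threeIsogenyCodomain m s)
    (fun φ hφ hsurj hker _ hc h0 => eq_zero_of_mem_sha_of_galH1Map_eq_zero_of_QKill canonical_b_ne_zero
      canonical_d_ne_zero (t := 3) (by norm_num) (by ring) (by ring) S hS hout hp₀ hp₀1 hsp hDp hg hg0 c y hcert hy0 hq₀ hc₀ f hf hgenQ φ hφ hsurj hker hc h0)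
    a₃ b₃ hb₃ hd₃ hX₃ hy hbox

/-! ## Booking: cut ℚ-box × (`K3`-box with one split prime cut at a killing place) -/

/-- Reassociation under the cast (private). [cite: CohenPazuki2009, Theorem 2.1 (2)] -/
private theorem not_mem_assocQ {N p : ℕ} {w : HeightOneSpectrum (𝓞 K3)} (hw : ((3 * N * p : ℕ) : 𝓞 K3) ∉ w.asIdeal) :
    ((3 * (N * p) : ℕ) : 𝓞 K3) ∉ w.asIdeal := by
  rwa [← mul_assoc]

/-- **`Ш(E/ℚ)[3] = 0` for `E = threeTorsionModel m s`: ℚ-box cut at the node prime `p₀`, `K3`-box `⟨[ζ], [ϖϖ̄²]⟩` cut at a killing place `w₀ ∣ s`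
with ONE `K3`-point** (the hypotheses of `forall_mem_sha_three_nsmul_eq_zero_of_gens_splitNodeKill` with `hgen` replaced by the ℚ-kill data).
[cite: CohenPazuki2009, Theorem 2.1 and Proposition 2.2] [cite: SilvermanAEC2009, Thm. X.4.2 (a)] -/
theorem forall_mem_sha_three_nsmul_eq_zero_of_QKill_splitNodeKill {m s : ℚ} [(threeTorsionModel m s).IsElliptic]
    (S : Finset ℕ) (hS : ∀ q ∈ S, q.Prime)
    (hout : ∀ q : ℕ, q.Prime → q ∉ S → padicValRat q (2 * s) = 0 ∧ 0 ≤ padicValRat q (2 * m))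
    {p₀ : ℕ} (hp₀ : p₀.Prime) (hp₀1 : p₀ % 3 = 1)
    (hsp : padicValRat p₀ s = 0) (hDp : 0 < padicValRat p₀ (27 * s - 4 * m ^ 3))
    {g : ℕ} (hg : (g : ZMod p₀) ^ ((p₀ - 1) / 3) ≠ 1) (hg0 : (g : ZMod p₀) ≠ 0)
    (c y : ℕ → ℕ) (hcert : ∀ q ∈ S, ((q : ℕ) : ZMod p₀) = (g : ZMod p₀) ^ c q * ((y q : ℕ) : ZMod p₀) ^ 3)
    (hy0 : ∀ q ∈ S, ((y q : ℕ) : ZMod p₀) ≠ 0)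
    {q₀ : ℕ} (hq₀ : q₀ ∈ S) (hc₀ : ¬ 3 ∣ c q₀) (f : ℕ → ℕ) (hf : ∀ q ∈ S, q ≠ q₀ → 3 ∣ c q + c q₀ * f q)
    (hgenQ : ∀ q ∈ S, q ≠ q₀ → cubeClass ((q : ℚ) * (q₀ : ℚ) ^ f q) ∈ Subgroup.closure (Set.range
      fun P : (threeTorsionModel m s).toAffine.Point => descentClass (threeTorsionModel m s) m s P))
    {N : ℕ} (hN0 : N ≠ 0) (hN : ∀ q ∈ N.primeFactors, q = 2 ∨ q % 3 = 2)
    {p : ℕ} (hp : p.Prime) (hp1 : p % 3 = 1) {a b : ℤ} (hab : a ^ 2 - a * b + b ^ 2 = p)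
    (hvb : ∀ w : HeightOneSpectrum (𝓞 K3), ((3 * N * p : ℕ) : 𝓞 K3) ∉ w.asIdeal →
      w.valuation K3 (algebraMap ℚ K3 (2 * (3 * s - 4 * m ^ 3 / 9))) = 1)
    (hvm : ∀ w : HeightOneSpectrum (𝓞 K3), ((3 * N * p : ℕ) : 𝓞 K3) ∉ w.asIdeal →
      w.valuation K3 (algebraMap ℚ K3 (2 * m)) ≤ 1)
    (w₀ : HeightOneSpectrum (𝓞 K3)) (hw₀ : ((3 * N * p : ℕ) : 𝓞 K3) ∉ w₀.asIdeal) (hw₀2 : w₀.valuation K3 2 = 1)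
    (hw₀s : w₀.valuation K3 (algebraMap ℚ K3 s) < 1) (hw₀9 : ¬ 9 ∣ Ideal.absNorm w₀.asIdeal - 1)
    {c₀ : ℕ} {y₀ : 𝓞 K3} (hcertK : mkInt a b * mkInt (a - b) (-b) ^ 2 - zetaInt ^ c₀ * y₀ ^ 3 ∈ w₀.asIdeal)
    {e₁ e₂ : ℕ} (he₁ : 3 ∣ e₁ + c₀) (he₂ : 3 ∣ e₂ + 2 * c₀)
    (hgen₃ : ∀ θ₀ : K3, θ₀ ^ 2 = -3 →
      cubeClass ((zeta : K3) ^ e₁ * ((⟨a, b⟩ : K3) * (⟨a - b, -b⟩ : K3) ^ 2)) ∈ Subgroup.closure (Set.range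
        fun P : (threeTorsionModel (algebraMap ℚ K3 m * θ₀) (algebraMap ℚ K3 (3 * s - 4 * m ^ 3 / 9) * θ₀)).toAffine.Point =>
          descentClass (threeTorsionModel (algebraMap ℚ K3 m * θ₀) (algebraMap ℚ K3 (3 * s - 4 * m ^ 3 / 9) * θ₀))
            (algebraMap ℚ K3 m * θ₀) (algebraMap ℚ K3 (3 * s - 4 * m ^ 3 / 9) * θ₀) P) ∨
      cubeClass ((zeta : K3) ^ e₂ * ((⟨a, b⟩ : K3) ^ 2 * (⟨a - b, -b⟩ : K3))) ∈ Subgroup.closure (Set.range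
        fun P : (threeTorsionModel (algebraMap ℚ K3 m * θ₀) (algebraMap ℚ K3 (3 * s - 4 * m ^ 3 / 9) * θ₀)).toAffine.Point =>
          descentClass (threeTorsionModel (algebraMap ℚ K3 m * θ₀) (algebraMap ℚ K3 (3 * s - 4 * m ^ 3 / 9) * θ₀))
            (algebraMap ℚ K3 m * θ₀) (algebraMap ℚ K3 (3 * s - 4 * m ^ 3 / 9) * θ₀) P)) :
    ∀ c' ∈ (threeTorsionModel m s).sha, 3 • c' = 0 → c' = 0 :=
  forall_mem_sha_three_nsmul_eq_zero_of_QKill_of_box S hS hout hp₀ hp₀1 hsp hDp hg hg0 c y hcert hy0 hq₀ hc₀ f hf hgenQ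
    (fun θ₀ => -(algebraMap ℚ K3 m / 3) * θ₀) (fun θ₀ => -(algebraMap ℚ K3 s / 3) * θ₀)
    (fun _ hθ => canonical₃_b_ne_zero (m := m) hθ) (fun _ hθ => canonical₃_d_ne_zero hθ)
    (fun _ hθ => canonical₃_baseChange_eq hθ) (fun _ hθ => canonical₃_hy hθ)
    (fun θ₀ hθ _ hu hsha hnorm => torsorClass_eq_zero_of_mem_sha_of_norm_cube_of_gen_splitNodeKill hN0 hN hp hp1 hab
      (canonical₃_b_ne_zero (m := m) hθ) (canonical₃_d_ne_zero hθ) (t := -1) (by norm_num) canonical₃_hm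
      (canonical₃_hs hθ) (fun w hw => canonical₃_valuation_s hθ (not_mem_assocQ hw) (hvb w hw))
      (fun w hw => canonical₃_valuation_m hθ (not_mem_assocQ hw) (hvm w hw)) w₀ hw₀ hw₀2
      (canonical₃_valuation_s₃ hθ (not_mem_assocQ hw₀) hw₀2 (hvb w₀ hw₀))
      (canonical₃_valuation_D hθ (not_mem_assocQ hw₀) hw₀s) hw₀9 hcertK he₁ he₂ (hgen₃ θ₀ hθ) hu hsha hnorm)

/-- **`t_3(E_{m,s}) = corank_{ℤ₃} Ш(E/ℚ)[3^∞] = 0` BOOKED from the cut ℚ-box (node prime `p₀`, certificates, `|S| − 1` rational points) and the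
`K3`-box with one split prime cut at a killing place (one `K3`-point).** [cite: CohenPazuki2009, Proposition 2.2] [cite: SilvermanAEC2009, Thm. X.4.2 (a)] -/
theorem shaCorank_three_eq_zero_of_QKill_splitNodeKill {m s : ℚ} [(threeTorsionModel m s).IsElliptic]
    (S : Finset ℕ) (hS : ∀ q ∈ S, q.Prime)
    (hout : ∀ q : ℕ, q.Prime → q ∉ S → padicValRat q (2 * s) = 0 ∧ 0 ≤ padicValRat q (2 * m))
    {p₀ : ℕ} (hp₀ : p₀.Prime) (hp₀1 : p₀ % 3 = 1)
    (hsp : padicValRat p₀ s = 0) (hDp : 0 < padicValRat p₀ (27 * s - 4 * m ^ 3))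
    {g : ℕ} (hg : (g : ZMod p₀) ^ ((p₀ - 1) / 3) ≠ 1) (hg0 : (g : ZMod p₀) ≠ 0)
    (c y : ℕ → ℕ) (hcert : ∀ q ∈ S, ((q : ℕ) : ZMod p₀) = (g : ZMod p₀) ^ c q * ((y q : ℕ) : ZMod p₀) ^ 3)
    (hy0 : ∀ q ∈ S, ((y q : ℕ) : ZMod p₀) ≠ 0)
    {q₀ : ℕ} (hq₀ : q₀ ∈ S) (hc₀ : ¬ 3 ∣ c q₀) (f : ℕ → ℕ) (hf : ∀ q ∈ S, q ≠ q₀ → 3 ∣ c q + c q₀ * f q)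
    (hgenQ : ∀ q ∈ S, q ≠ q₀ → cubeClass ((q : ℚ) * (q₀ : ℚ) ^ f q) ∈ Subgroup.closure (Set.range
      fun P : (threeTorsionModel m s).toAffine.Point => descentClass (threeTorsionModel m s) m s P))
    {N : ℕ} (hN0 : N ≠ 0) (hN : ∀ q ∈ N.primeFactors, q = 2 ∨ q % 3 = 2)
    {p : ℕ} (hp : p.Prime) (hp1 : p % 3 = 1) {a b : ℤ} (hab : a ^ 2 - a * b + b ^ 2 = p)
    (hvb : ∀ w : HeightOneSpectrum (𝓞 K3), ((3 * N * p : ℕ) : 𝓞 K3) ∉ w.asIdeal →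
      w.valuation K3 (algebraMap ℚ K3 (2 * (3 * s - 4 * m ^ 3 / 9))) = 1)
    (hvm : ∀ w : HeightOneSpectrum (𝓞 K3), ((3 * N * p : ℕ) : 𝓞 K3) ∉ w.asIdeal →
      w.valuation K3 (algebraMap ℚ K3 (2 * m)) ≤ 1)
    (w₀ : HeightOneSpectrum (𝓞 K3)) (hw₀ : ((3 * N * p : ℕ) : 𝓞 K3) ∉ w₀.asIdeal) (hw₀2 : w₀.valuation K3 2 = 1)
    (hw₀s : w₀.valuation K3 (algebraMap ℚ K3 s) < 1) (hw₀9 : ¬ 9 ∣ Ideal.absNorm w₀.asIdeal - 1)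
    {c₀ : ℕ} {y₀ : 𝓞 K3} (hcertK : mkInt a b * mkInt (a - b) (-b) ^ 2 - zetaInt ^ c₀ * y₀ ^ 3 ∈ w₀.asIdeal)
    {e₁ e₂ : ℕ} (he₁ : 3 ∣ e₁ + c₀) (he₂ : 3 ∣ e₂ + 2 * c₀)
    (hgen₃ : ∀ θ₀ : K3, θ₀ ^ 2 = -3 →
      cubeClass ((zeta : K3) ^ e₁ * ((⟨a, b⟩ : K3) * (⟨a - b, -b⟩ : K3) ^ 2)) ∈ Subgroup.closure (Set.range
        fun P : (threeTorsionModel (algebraMap ℚ K3 m * θ₀) (algebraMap ℚ K3 (3 * s - 4 * m ^ 3 / 9) * θ₀)).toAffine.Point =>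
          descentClass (threeTorsionModel (algebraMap ℚ K3 m * θ₀) (algebraMap ℚ K3 (3 * s - 4 * m ^ 3 / 9) * θ₀))
            (algebraMap ℚ K3 m * θ₀) (algebraMap ℚ K3 (3 * s - 4 * m ^ 3 / 9) * θ₀) P) ∨
      cubeClass ((zeta : K3) ^ e₂ * ((⟨a, b⟩ : K3) ^ 2 * (⟨a - b, -b⟩ : K3))) ∈ Subgroup.closure (Set.range
        fun P : (threeTorsionModel (algebraMap ℚ K3 m * θ₀) (algebraMap ℚ K3 (3 * s - 4 * m ^ 3 / 9) * θ₀)).toAffine.Point =>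
          descentClass (threeTorsionModel (algebraMap ℚ K3 m * θ₀) (algebraMap ℚ K3 (3 * s - 4 * m ^ 3 / 9) * θ₀))
            (algebraMap ℚ K3 m * θ₀) (algebraMap ℚ K3 (3 * s - 4 * m ^ 3 / 9) * θ₀) P)) :
    (threeTorsionModel m s).shaCorank 3 = 0 :=
  haveI : Fact (Nat.Prime 3) := ⟨Nat.prime_three⟩
  shaCorank_eq_zero_of_forall _ 3 (forall_mem_sha_three_nsmul_eq_zero_of_QKill_splitNodeKill S hS hout hp₀ hp₀1 hsp hDp hg hg0 c y hcert hy0 hq₀ hc₀ f hf hgenQ hN0 hN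
    hp hp1 hab hvb hvm w₀ hw₀ hw₀2 hw₀s hw₀9 hcertK he₁ he₂ hgen₃)

end CPMuDescent

end Literature.NumberTheory.EllipticCurves

end
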